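import Summits.Ventures.CertifiedManyBodySolver.Upper.StripCellStructure
import HarnessLib

/-!
# Route `R2cOpenStripTangentLine`, writer (ii) add-on 3/4 (route pen sr-mbsolver-var-7): ROW SUMS OF THE STRIP CELL BOND MATRIX (producer-free)

HONEST FRAMING: first certified bounds; not a superconductivity verdict; every number certified or labelled float.
NO NUMBER IS CLAIMED HERE. No certificate `≤ −18/25` per site at density `7/8` exists today — the route's cruxes stay OPEN.

Every Jordan–Wigner word is a product operator of row-contractions (`rowSum_productOp_le_one`); `superSite κ` and `⊗ 1` preserve
row sums; hence **`stripCellBondMatrix_rowSum_le`**: `Σ_{p'} |hh p p'| ≤ |t|·(Σ_{f,f'}[f ∼ f']·2 + 4W) + |U|·cW` =: `stripCellRowBound`.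
Sources: Essler et al. (2005) §12.3.4; Horn–Johnson (2013) §5.6 [HornJohnson2013].
-/

noncomputable section

open Matrix Finset
open scoped ComplexOrder BigOperators Kronecker

namespace Summit.Ventures.CertifiedManyBodySolver.Upper

open Literature.MathematicalPhysics.QuantumLattice
open Literature.MathematicalPhysics.QuantumLattice.JordanWigner
open Literature.LinearAlgebra.Matrix.PolarOrthonormalization
open Summit.Ventures.CertifiedManyBodySolver.Theorems

/-! ### Part R — row-sum (`ℓ∞ → ℓ∞`) bounds: generic lemmas -/

section RowSumGeneric

variable {m n p ι : Type*} [Fintype n]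

/-- Row sums are subadditive. [folklore] -/
theorem rowSum_add_le (A B : Matrix m n ℂ) {a b : ℝ}
    (hA : ∀ i, ∑ j, ‖A i j‖ ≤ a) (hB : ∀ i, ∑ j, ‖B i j‖ ≤ b) : ∀ i, ∑ j, ‖(A + B) i j‖ ≤ a + b := by
  intro i
  calc ∑ j, ‖(A + B) i j‖ ≤ ∑ j, (‖A i j‖ + ‖B i j‖) := Finset.sum_le_sum fun j _ => norm_add_le _ _
    _ = ∑ j, ‖A i j‖ + ∑ j, ‖B i j‖ := Finset.sum_add_distrib
    _ ≤ a + b := add_le_add (hA i) (hB i)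

/-- Row sums scale with the modulus of a scalar. [folklore] -/
theorem rowSum_smul_le (A : Matrix m n ℂ) (c : ℂ) {a : ℝ}
    (hA : ∀ i, ∑ j, ‖A i j‖ ≤ a) : ∀ i, ∑ j, ‖(c • A) i j‖ ≤ ‖c‖ * a := by
  intro i
  calc ∑ j, ‖(c • A) i j‖ = ‖c‖ * ∑ j, ‖A i j‖ := by
          simp only [Matrix.smul_apply, smul_eq_mul, norm_mul, Finset.mul_sum]
    _ ≤ ‖c‖ * a := mul_le_mul_of_nonneg_left (hA i) (norm_nonneg c)

/-- Row sums of a finite sum of matrices. [folklore] -/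
theorem rowSum_sum_le (s : Finset ι) (A : ι → Matrix m n ℂ) {a : ι → ℝ}
    (hA : ∀ t ∈ s, ∀ i, ∑ j, ‖A t i j‖ ≤ a t) : ∀ i, ∑ j, ‖(∑ t ∈ s, A t) i j‖ ≤ ∑ t ∈ s, a t := by
  intro i
  calc ∑ j, ‖(∑ t ∈ s, A t) i j‖ = ∑ j, ‖∑ t ∈ s, A t i j‖ := by simp only [Matrix.sum_apply]
    _ ≤ ∑ j, ∑ t ∈ s, ‖A t i j‖ := Finset.sum_le_sum fun j _ => norm_sum_le _ _
    _ = ∑ t ∈ s, ∑ j, ‖A t i j‖ := Finset.sum_comm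
    _ ≤ ∑ t ∈ s, a t := Finset.sum_le_sum fun t ht => hA t ht i

/-- Row sums of a conditional term (the bound is only needed when the condition holds). [folklore] -/
theorem rowSum_ite_le (P : Prop) [Decidable P] (A : Matrix m n ℂ) {a : ℝ}
    (hA : P → ∀ i, ∑ j, ‖A i j‖ ≤ a) :
    ∀ i, ∑ j, ‖(if P then A else 0) i j‖ ≤ if P then a else 0 := by
  intro i
  split_ifs with h
  · exact hA h i
  · simp

/-- Row sums are submultiplicative. [folklore] -/
theorem rowSum_mul_le [Fintype p] (A : Matrix m n ℂ) (B : Matrix n p ℂ) {a b : ℝ}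
    (hb : 0 ≤ b) (hA : ∀ i, ∑ j, ‖A i j‖ ≤ a) (hB : ∀ j, ∑ k, ‖B j k‖ ≤ b) :
    ∀ i, ∑ k, ‖(A * B) i k‖ ≤ a * b := by
  intro i
  calc ∑ k, ‖(A * B) i k‖ = ∑ k, ‖∑ j, A i j * B j k‖ := by simp only [Matrix.mul_apply]
    _ ≤ ∑ k, ∑ j, ‖A i j‖ * ‖B j k‖ :=
        Finset.sum_le_sum fun k _ => (norm_sum_le _ _).trans (le_of_eq (by simp only [norm_mul]))
    _ = ∑ j, ‖A i j‖ * ∑ k, ‖B j k‖ := by rw [Finset.sum_comm]; simp only [Finset.mul_sum]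
    _ ≤ ∑ j, ‖A i j‖ * b :=
        Finset.sum_le_sum fun j _ => mul_le_mul_of_nonneg_left (hB j) (norm_nonneg _)
    _ = (∑ j, ‖A i j‖) * b := by rw [Finset.sum_mul]
    _ ≤ a * b := mul_le_mul_of_nonneg_right (hA i) hb

/-- Row sums of the identity. [folklore] -/
theorem rowSum_one_le_one [DecidableEq n] : ∀ i : n, ∑ j, ‖(1 : Matrix n n ℂ) i j‖ ≤ 1 := by
  intro i
  rw [Finset.sum_eq_single i]
  · simp
  · intro j _ hji
    rw [Matrix.one_apply_ne (Ne.symm hji), norm_zero]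
  · intro h
    exact absurd (Finset.mem_univ i) h

/-- Row sums of a diagonal matrix. [folklore] -/
theorem rowSum_diagonal_le [DecidableEq n] (d : n → ℂ) {a : ℝ} (hd : ∀ i, ‖d i‖ ≤ a) :
    ∀ i : n, ∑ j, ‖diagonal d i j‖ ≤ a := by
  intro i
  rw [Finset.sum_eq_single i]
  · simpa only [diagonal_apply_eq] using hd i
  · intro j _ hji
    rw [diagonal_apply_ne _ (Ne.symm hji), norm_zero]
  · intro h
    exact absurd (Finset.mem_univ i) h

/-- Row sums of a Kronecker product factor. [folklore] -/
theorem rowSum_kronecker {m' n' : Type*} [Fintype n'] (A : Matrix m n ℂ) (B : Matrix m' n' ℂ)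
    (i : m) (i' : m') :
    ∑ jj : n × n', ‖(A ⊗ₖ B) (i, i') jj‖ = (∑ j, ‖A i j‖) * ∑ j', ‖B i' j'‖ := by
  rw [Fintype.sum_prod_type, Finset.sum_mul_sum]
  simp only [Matrix.kroneckerMap_apply, norm_mul]

end RowSumGeneric

/-! ### Part R — product operators, super-sites, site matrices -/

section RowSumWords

/-- **A product operator of row-contractions is a row-contraction**: if every factor has row sums `≤ 1`,
so does `⨂ u` (its row sums are the products of the factors' row sums). [folklore] -/
theorem rowSum_productOp_le_one {Λ : Type*} [Fintype Λ] [DecidableEq Λ] {q : ℕ}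
    (u : Λ → Matrix (Fin q) (Fin q) ℂ) (hu : ∀ z a, ∑ b, ‖u z a b‖ ≤ 1) :
    ∀ σ : TensorIndex Λ q, ∑ τ, ‖productOp u σ τ‖ ≤ 1 := by
  intro σ
  calc ∑ τ, ‖productOp u σ τ‖ = ∑ τ : TensorIndex Λ q, ∏ z, ‖u z (σ z) (τ z)‖ := by
          simp only [productOp_apply, norm_prod]
    _ = ∏ z, ∑ b, ‖u z (σ z) b‖ := (Fintype.prod_sum fun z b => ‖u z (σ z) b‖).symm
    _ ≤ 1 := Finset.prod_le_one (fun z _ => Finset.sum_nonneg fun b _ => norm_nonneg _)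
          fun z _ => hu z (σ z)

/-- `superSite κ` is a reindexing: row sums are preserved. [folklore] -/
theorem rowSum_superSite {F : Type*} [Fintype F] [DecidableEq F] {q Q : ℕ}
    (κ : TensorIndex F q ≃ Fin Q) (O : Op F q) (S : Fin Q) :
    ∑ S', ‖superSite κ O S S'‖ = ∑ τ, ‖O (κ.symm S) τ‖ := by
  simp only [superSite_apply]
  exact κ.symm.sum_comp (fun τ => ‖O (κ.symm S) τ‖)

/-- Row sums of the site parity `F = diag(±1)`. [folklore] -/
theorem rowSum_siteParity_le_one : ∀ a, ∑ b, ‖siteParity a b‖ ≤ 1 :=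
  rowSum_diagonal_le _ fun a => by simp

/-- Row sums of the double occupancy `diag(0,0,0,1)`. [folklore] -/
theorem rowSum_siteDouble_le_one : ∀ a, ∑ b, ‖siteDouble a b‖ ≤ 1 :=
  rowSum_diagonal_le _ fun a => by split_ifs <;> simp

/-- Row sums of the site annihilation matrices `c_↑ = e₁² + e₃⁴`, `c_↓ = e₁³ − e₂⁴`. [folklore] -/
theorem rowSum_siteAnnihilation_le_one (σ : Fin 2) : ∀ a, ∑ b, ‖siteAnnihilation σ a b‖ ≤ 1 := by
  intro a
  fin_cases σ
  · rw [show siteAnnihilation ⟨0, by norm_num⟩ = _ from siteAnnihilation_zero_eq]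
    fin_cases a <;> simp [Fin.sum_univ_four]
  · rw [show siteAnnihilation ⟨1, by norm_num⟩ = _ from siteAnnihilation_one_eq]
    fin_cases a <;> simp [Fin.sum_univ_four]

/-- Row sums of the site creation matrices `c†_σ = (c_σ)ᴴ`. [folklore] -/
theorem rowSum_siteCreation_le_one (σ : Fin 2) : ∀ a, ∑ b, ‖siteCreation σ a b‖ ≤ 1 := by
  intro a
  simp only [siteCreation, conjTranspose_apply, norm_star]
  fin_cases σ
  · rw [show siteAnnihilation ⟨0, by norm_num⟩ = _ from siteAnnihilation_zero_eq]
    fin_cases a <;> simp [Fin.sum_univ_four]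
  · rw [show siteAnnihilation ⟨1, by norm_num⟩ = _ from siteAnnihilation_one_eq]
    fin_cases a <;> simp [Fin.sum_univ_four]

variable {Λ : Type*} [LinearOrder Λ]

/-- Row sums of the string factors (`F` or `1`). [folklore] -/
theorem rowSum_stringFamily_le_one (x y z : Λ) : ∀ a, ∑ b, ‖stringFamily x y z a b‖ ≤ 1 := by
  intro a
  unfold stringFamily
  split_ifs
  · exact rowSum_siteParity_le_one a
  · exact rowSum_one_le_one a

/-- Row sums of the hopping-word factors. [folklore] -/
theorem rowSum_jwWordFamily_le_one (x y : Λ) {A B : Matrix (Fin 4) (Fin 4) ℂ}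
    (hA : ∀ a, ∑ b, ‖A a b‖ ≤ 1) (hB : ∀ a, ∑ b, ‖B a b‖ ≤ 1) :
    ∀ z a, ∑ b, ‖jwWordFamily x y A B z a b‖ ≤ 1 := by
  intro z
  unfold jwWordFamily
  rcases eq_or_ne z y with rfl | hzy
  · rw [Function.update_self]
    simpa only [one_mul] using
      rowSum_mul_le _ _ zero_le_one (rowSum_stringFamily_le_one x z z) hB
  · rw [Function.update_of_ne hzy]
    rcases eq_or_ne z x with rfl | hzx
    · rw [Function.update_self]
      simpa only [one_mul] using
        rowSum_mul_le _ _ zero_le_one hA (rowSum_stringFamily_le_one z y z)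
    · rw [Function.update_of_ne hzx]
      exact rowSum_stringFamily_le_one x y z

variable {c W : ℕ}

/-- Row sums of the left inter-cell half-word factors (`M`, `F` or `1`). [folklore] -/
theorem rowSum_interLeftFamily_le_one (hc : 0 < c) (y₀ : Fin W) {M : Matrix (Fin 4) (Fin 4) ℂ}
    (hM : ∀ a, ∑ b, ‖M a b‖ ≤ 1) : ∀ f a, ∑ b, ‖interLeftFamily hc y₀ M f a b‖ ≤ 1 := by
  intro f a
  unfold interLeftFamily
  split_ifs
  · exact hM a
  · exact rowSum_siteParity_le_one a
  · exact rowSum_one_le_one a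
  · exact rowSum_one_le_one a

/-- Row sums of the right inter-cell half-word factors. [folklore] -/
theorem rowSum_interRightFamily_le_one (hc : 0 < c) (y₀ : Fin W) {M : Matrix (Fin 4) (Fin 4) ℂ}
    (hM : ∀ a, ∑ b, ‖M a b‖ ≤ 1) : ∀ f a, ∑ b, ‖interRightFamily hc y₀ M f a b‖ ≤ 1 := by
  intro f a
  unfold interRightFamily
  split_ifs
  · exact hM a
  · exact rowSum_siteParity_le_one a
  · exact rowSum_one_le_one a
  · exact rowSum_one_le_one a

end RowSumWords

/-! ### Part R — the cell Hamiltonian, the inter-cell coupling, the cell bond matrix -/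

section RowSumStrip

variable {c W Q : ℕ}

/-- **Row sums of the Jordan–Wigner image of the Hubbard Hamiltonian on any finite graph**: every hopping
word `c†_{xσ} F⋯F c_{yσ}` and every `n_↑n_↓` is a product operator of row-contractions, hence
`Σ_τ |⟨σ|H|τ⟩| ≤ |t|·#{(x, y, σ) : x ∼ y} + |U|·|Λ|`. [folklore] -/
theorem rowSum_toSpin_hamiltonian_le {Λ : Type*} [LinearOrder Λ] [Fintype Λ]
    (G : SimpleGraph Λ) [DecidableRel G.Adj] (t U : ℝ) :
    ∀ σ, ∑ τ, ‖toSpin (hamiltonian G t U) σ τ‖ ≤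
      |t| * (∑ x : Λ, ∑ y : Λ, if G.Adj x y then (2 : ℝ) else 0) + |U| * Fintype.card Λ := by
  rw [toSpin_hamiltonian]
  have hhop : ∀ σ, ∑ τ, ‖(∑ x : Λ, ∑ y : Λ, ∑ s : Fin 2, if G.Adj x y then
      onSite x (siteCreation s) * (jwString x * jwString y) * onSite y (siteAnnihilation s) else 0) σ τ‖ ≤
      ∑ x : Λ, ∑ y : Λ, if G.Adj x y then (2 : ℝ) else 0 := by
    refine rowSum_sum_le _ _ fun x _ => rowSum_sum_le _ _ fun y _ => ?_
    have h2 : (∑ _s : Fin 2, if G.Adj x y then (1 : ℝ) else 0) = if G.Adj x y then (2 : ℝ) else 0 := by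
      split_ifs <;> simp
    rw [← h2]
    refine rowSum_sum_le _ _ fun s _ => rowSum_ite_le _ _ fun hxy => ?_
    rw [onSite_mul_jwString_mul_jwString_mul_onSite hxy.ne]
    exact rowSum_productOp_le_one _
      (rowSum_jwWordFamily_le_one x y (rowSum_siteCreation_le_one s) (rowSum_siteAnnihilation_le_one s))
  have hU : ∀ σ, ∑ τ, ‖(∑ x : Λ, onSite x siteDouble) σ τ‖ ≤ ∑ _x : Λ, (1 : ℝ) := by
    refine rowSum_sum_le _ _ fun x _ => ?_
    rw [onSite_eq_productOp]
    refine rowSum_productOp_le_one _ fun z a => ?_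
    rcases eq_or_ne z x with rfl | hzx
    · rw [Function.update_self]; exact rowSum_siteDouble_le_one a
    · rw [Function.update_of_ne hzx]; exact rowSum_one_le_one a
  intro σ
  have h := rowSum_add_le _ _ (rowSum_smul_le _ (-(t : ℂ)) hhop) (rowSum_smul_le _ (U : ℂ) hU) σ
  have ht : ‖(-(t : ℂ))‖ = |t| := by rw [norm_neg, Complex.norm_real, Real.norm_eq_abs]
  have hU' : ‖(U : ℂ)‖ = |U| := by rw [Complex.norm_real, Real.norm_eq_abs]
  have hcard : (∑ _x : Λ, (1 : ℝ)) = Fintype.card Λ := by simp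
  rw [ht, hU', hcard] at h
  exact h

/-- **Row sums of the inter-cell coupling**: `4·W` half-word pairs, each a Kronecker product of two
row-contractions ⇒ `≤ 4·W·|t|`. [folklore] -/
theorem rowSum_interCellMatrix_le (κ : TensorIndex (Fin c ×ₗ Fin W) 4 ≃ Fin Q) (hc : 0 < c) (t : ℝ) :
    ∀ p, ∑ p', ‖interCellMatrix κ hc t p p'‖ ≤ |t| * (4 * W) := by
  have hpair : ∀ (u v : (Fin c ×ₗ Fin W) → Matrix (Fin 4) (Fin 4) ℂ),
      (∀ f a, ∑ b, ‖u f a b‖ ≤ 1) → (∀ f a, ∑ b, ‖v f a b‖ ≤ 1) →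
      ∀ p : Fin Q × Fin Q, ∑ p', ‖(superSite κ (productOp u) ⊗ₖ superSite κ (productOp v)) p p'‖ ≤ 1 := by
    intro u v hu hv p
    obtain ⟨S, S'⟩ := p
    rw [rowSum_kronecker, rowSum_superSite, rowSum_superSite]
    calc (∑ τ, ‖productOp u (κ.symm S) τ‖) * ∑ τ, ‖productOp v (κ.symm S') τ‖ ≤ 1 * 1 :=
          mul_le_mul (rowSum_productOp_le_one u hu _) (rowSum_productOp_le_one v hv _)
            (Finset.sum_nonneg fun _ _ => norm_nonneg _) zero_le_one
      _ = 1 := one_mul 1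
  have hsum : ∀ p, ∑ p', ‖(∑ y₀ : Fin W, ∑ σ : Fin 2,
      (superSite κ (productOp (interLeftFamily hc y₀ (siteCreation σ * siteParity))) ⊗ₖ
          superSite κ (productOp (interRightFamily hc y₀ (siteAnnihilation σ))) +
        superSite κ (productOp (interLeftFamily hc y₀ (siteParity * siteAnnihilation σ))) ⊗ₖ
          superSite κ (productOp (interRightFamily hc y₀ (siteCreation σ))))) p p'‖ ≤
      ∑ _y₀ : Fin W, ∑ _σ : Fin 2, ((1 : ℝ) + 1) := by
    refine rowSum_sum_le _ _ fun y₀ _ => rowSum_sum_le _ _ fun σ _ => rowSum_add_le _ _ ?_ ?_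
    · refine hpair _ _ (rowSum_interLeftFamily_le_one hc y₀ ?_)
        (rowSum_interRightFamily_le_one hc y₀ (rowSum_siteAnnihilation_le_one σ))
      simpa only [one_mul] using
        rowSum_mul_le _ _ zero_le_one (rowSum_siteCreation_le_one σ) rowSum_siteParity_le_one
    · refine hpair _ _ (rowSum_interLeftFamily_le_one hc y₀ ?_)
        (rowSum_interRightFamily_le_one hc y₀ (rowSum_siteCreation_le_one σ))
      simpa only [one_mul] using
        rowSum_mul_le _ _ zero_le_one rowSum_siteParity_le_one (rowSum_siteAnnihilation_le_one σ)
  intro p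
  unfold interCellMatrix
  have h := rowSum_smul_le _ (-(t : ℂ)) hsum p
  have ht : ‖(-(t : ℂ))‖ = |t| := by rw [norm_neg, Complex.norm_real, Real.norm_eq_abs]
  have hW : (∑ _y₀ : Fin W, ∑ _σ : Fin 2, ((1 : ℝ) + 1)) = 4 * W := by
    simp only [Finset.sum_const, Finset.card_univ, Fintype.card_fin]
    ring
  rw [ht, hW] at h
  exact h

/-- **Row sums of the strip cell bond matrix** `hh = superSite κ (toSpin H_cell) ⊗ 1 + interCellMatrix`:
`Σ_{p'} |hh p p'| ≤ |t|·(#{(f, f', σ) : f ∼ f' in the c × W cell} + 4W) + |U|·(c·W)`. PRODUCER-FREE: with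
`stripCellBondMatrix_isHermitian` it discharges the Loewner inputs `γ·1 ∓ hh ⪰ 0` of Lemma P. [folklore] -/
theorem stripCellBondMatrix_rowSum_le (κ : TensorIndex (Fin c ×ₗ Fin W) 4 ≃ Fin Q) (hc : 0 < c) (t U : ℝ) :
    ∀ p, ∑ p', ‖stripCellBondMatrix κ hc t U p p'‖ ≤
      |t| * ((∑ f : Fin c ×ₗ Fin W, ∑ f' : Fin c ×ₗ Fin W, if (rectBoxGraph c W).Adj f f' then (2 : ℝ) else 0) +
        4 * W) + |U| * (c * W) := by
  intro p
  obtain ⟨S, S'⟩ := p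
  unfold stripCellBondMatrix
  have hintra : ∀ pp : Fin Q × Fin Q, ∑ p', ‖(superSite κ (toSpin (hubbardOpenBoxTT' c W t 0 U)) ⊗ₖ
      (1 : Matrix (Fin Q) (Fin Q) ℂ)) pp p'‖ ≤
      |t| * (∑ f : Fin c ×ₗ Fin W, ∑ f' : Fin c ×ₗ Fin W, if (rectBoxGraph c W).Adj f f' then (2 : ℝ) else 0) +
        |U| * (c * W) := by
    intro pp
    obtain ⟨T, T'⟩ := pp
    rw [rowSum_kronecker, rowSum_superSite, hubbardOpenBoxTT'_tPrime_zero]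
    have h1 := rowSum_toSpin_hamiltonian_le (rectBoxGraph c W) t U (κ.symm T)
    have hcard : (Fintype.card (Fin c ×ₗ Fin W) : ℝ) = c * W := by
      rw [Fintype.card_lex, Fintype.card_prod, Fintype.card_fin, Fintype.card_fin, Nat.cast_mul]
    rw [hcard] at h1
    calc (∑ τ, ‖toSpin (hamiltonian (rectBoxGraph c W) t U) (κ.symm T) τ‖) *
          ∑ j', ‖(1 : Matrix (Fin Q) (Fin Q) ℂ) T' j'‖ ≤
        (|t| * (∑ f : Fin c ×ₗ Fin W, ∑ f' : Fin c ×ₗ Fin W,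
          if (rectBoxGraph c W).Adj f f' then (2 : ℝ) else 0) + |U| * (c * W)) * 1 :=
          mul_le_mul h1 (rowSum_one_le_one T') (Finset.sum_nonneg fun _ _ => norm_nonneg _)
            ((Finset.sum_nonneg fun _ _ => norm_nonneg _).trans h1)
      _ = _ := mul_one _
  have h := rowSum_add_le _ _ hintra (rowSum_interCellMatrix_le κ hc t) (S, S')
  linarith

/-- **The row-sum constant of the strip cell bond matrix** at hopping `t`, interaction `U`:
`|t|·(#{(f, f', σ) : f ∼ f' in the open c × W cell} + 4W) + |U|·(c·W)` (the dart count is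
`Σ_{f,f'} [f ∼ f']·2`, two spins). -/
def stripCellRowBound (c W : ℕ) (t U : ℝ) : ℝ :=
  |t| * ((∑ f : Fin c ×ₗ Fin W, ∑ f' : Fin c ×ₗ Fin W, if (rectBoxGraph c W).Adj f f' then (2 : ℝ) else 0) +
    4 * W) + |U| * (c * W)

end RowSumStrip

end Summit.Ventures.CertifiedManyBodySolver.Upper

end
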